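import Literature.AnabelianGeometry.EtaleTheta.Discharge.Sec2Cor219iiiHeartPrelims
import Literature.AnabelianGeometry.EtaleTheta.Discharge.Sec2DtpYThetaAbelian
import HarnessLib

/-!
# [EtTh] Cor. 2.19 (iii): the even-level DISCREPANCY of a Δ-stable admissible automorphism is a SQUARE
# (row «COR219III-M1b-EVEN (β)», file 1 of 2 — GENERIC over every §1 setting at an origin; proof-only)

S. Mochizuki, *The Étale Theta Function and its Frobenioid-theoretic Manifestations* [EtTh], Publ. RIMS **45**
(2009), §1 p. 12 ("we have a natural exact sequence of abelian profinite groups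
`1 → Δ_Θ → (Δ^tp_Y)^Θ → (Δ^tp_Y)^ell → 1`", "`(Ẑ(1) ≅) Δ_Θ`"), §2 Cor. 2.19 (iii) p. 64 [cite: MochizukiEtTh2009, Cor 2.19 (iii) p.64].
Cell `abc-iut`, K-L6 row «COR219III-M1b-EVEN (β)» (abc-iut-L6-lead gen 7, §F v1.19cu/cz/dd), seat abc-iut-w5-d187 (gen 8).
PROOF-ONLY: no definition, no instance, no notation, no new named fact; inputs of other seats consumed BY NAME — abc-iut-f-142's
`rootCocycle_apply` / `apply_mul_of_aug_eq_one` / `toTheta_conj_zpow_comm` (`Sec2Cor219iiiHeartPrelims`, with abc-iut-L2-t8's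
`RigidOfSetting`), abc-iut-L2-t8's `ThetaSetting.dtpYTheta_comm` (`Sec2DtpYThetaAbelian`), abc-iut-C-hgal-2's binder shape
(`cor219_iii_of_hearts`, p482618).

THE QUESTION (β).  abc-iut-f-142's assembly of the level-`M` Δ_P-heart of Cor. 2.19 (iii) uses its surjectivity input at ONE
value, the DISCREPANCY `u₀(γ) := red_M(F b)·red_M(f b)⁻¹` of the transport `F = Φ_γ f` of a root cocycle `f` at a geometric
`b ∈ Π^tp_Ÿ̲̲`; at the stage-2 Tate model the commutator character only takes SQUARE values in `μ_M` (abc-iut-L1-t6, p487040), so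
at even `M` the heart needs `u₀(γ)` to be a square.  No structure theorem «admissible `γ` = `Ad(w) ∘` Galois-type» is available
(and that wording fails at the model: profinite-inner `Ad(â^u)`, abc-iut-L6-d6 g5 census (b)); this file proves (β) DIRECTLY for
every admissible `γ` keeping the square root `b̂` of `b` geometric.

WHAT IS SHOWN (any §1 setting `D` at an origin `D.IsEtThOrigin`, any `E`, any `X̲̲`-choice `C`, any cyclotome tower, any level).
* §0 `isSquare_mulEquiv_apply_mul_inv` — for an automorphism `φ` of a cyclic group, `φ t · t⁻¹` is a square ("units of `Ẑ` are odd").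
* §1 **`isSquare_transport_discrepancy_of_aug_apply_eq_one`** — `γ` admissible at the binder shape of `cor219_iii_of_hearts` (`γ`,
  `hγ`, clause (5) `hL`, `γ̃ = γΛ` with `hγΛ`, level-`M` `γ̄_M = γμ` with its compatibility), `f` a root cocycle, `F = Φ_γ f` (`hF`),
  `b = b̂²` with `b̂ ∈ Π^tp_X̲̲` geometric; IF `aug (γ b̂) = 1` THEN `red_M(F b)·red_M(f b)⁻¹` is a square in `μ_M`.  PROOF:
  `w := γ b̂ · b̂⁻¹ ∈ Π^tp_Ÿ̲̲` (both or neither of `γ b̂`, `b̂` lie in `Π^tp_Ÿ̲̲`, of index `2` in `Π^tp_Y`), geometric;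
  `γ b = w · (b̂ w b̂⁻¹) · b`; root cocycles are multiplicative and `θ`-determined on geometric elements (Prop. 1.5 (iii) via
  `rootCocycle_apply`) and `θ(b̂ w b̂⁻¹) = θ w` since `(Δ^tp_Y)^Θ` is abelian; so `f(γ b) = f(w)² f(b)` and
  `u₀ = γ̄_M⁻¹(red_M f w)² · (γ̄_M⁻¹ t · t⁻¹)`, `t = red_M f b`, a square by §0 (`red_M ∘ γ̃⁻¹ = γ̄_M⁻¹ ∘ red_M`: `red_lDeltaAut_eq`).
* `exists_zpow_red_comm_eq_discrepancy_of_aug_apply_eq_one` — SOCKET FORM for abc-iut-L1-t6's `heart_of_uniqueness_at'`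
  (p488904): if every square of `μ_M` is a commutator value `red_M θ⁅(ã^m)⁻¹, b⁆` then the discrepancy is one (`hred`);
  `forall_sq_eq_red_comm_of_eq_zpow_neg_two` — that hypothesis from ONE identity `⟨θ⁅ã⁻¹, b⁆⟩ = x₀^{-2}` with `red_M x₀`
  generating `μ_M` (the shape abc-iut-L1-t6 computes at the Tate model).  File 2 (`Sec2Cor218AdmissibleAutAtModelChi`) draws the
  heart and instantiates everything at `modelχq p i j`.
RESIDUAL: only `aug (γ b̂) = 1` beyond the admissibility binders (Δ-stability at one element; automatic for Δ_X̲̲-stabilising `γ`;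
for arbitrary admissible `γ` it follows at the model from «`G_K` has no non-trivial tfg closed normal nilpotent subgroup», being filed
from the tree's slimness/elasticity by abc-iut-f-153 — not assumed here).
HONEST FRAMING: statements about OUR typed §1/§2 interface (binder-discharge evidence), not about the tempered fundamental group of a
curve; nothing of [EtTh] (refereed) is asserted or denied for a curve; no side is taken on [IUTchIII] Cor. 3.12; typed ≠ proved;
nothing here asserts abc proved or refuted.
-/
noncomputable section

namespace Literature.AnabelianGeometry.EtaleTheta

open Literature.AnabelianGeometry.SemiGraphs

/-! ## §0 Automorphisms of a cyclic group move every element by a square -/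

/-- **`φ t · t⁻¹` is a square** for every automorphism `φ` of a cyclic group and every `t`: with a generator `g` and `φ g = g^k`,
either `k` is odd and `φ(g^n)·g^{-n} = (g^{(k−1)/2·n})²`, or `k` is even and EVERY element `x = φ(g^m) = ((g^{k/2})^m)²` is a
square.  ("Units of `Ẑ` are odd", in the only form the heart needs.) [cite: NeukirchSchmidtWingberg2008, I §5] -/
theorem isSquare_mulEquiv_apply_mul_inv {G : Type*} [CommGroup G] [IsCyclic G] (φ : G ≃* G) (t : G) :
    IsSquare (φ t * t⁻¹) := by
  obtain ⟨g, hg⟩ := IsCyclic.exists_generator (α := G)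
  obtain ⟨k, hk⟩ := Subgroup.mem_zpowers_iff.mp (hg (φ g))
  rcases Int.even_or_odd k with ⟨r, hr⟩ | ⟨r, hr⟩
  · -- `k = r + r`: every element is `φ` of a power of `g`, hence an even power of `g ^ r`
    obtain ⟨m, hm⟩ := Subgroup.mem_zpowers_iff.mp (hg (φ.symm (φ t * t⁻¹)))
    refine ⟨(g ^ r) ^ m, ?_⟩
    have h1 : φ t * t⁻¹ = φ (g ^ m) := by rw [hm, MulEquiv.apply_symm_apply]
    rw [h1, map_zpow, ← hk, hr, zpow_add, mul_zpow]
  · -- `k = 2 r + 1`: `φ (g ^ n) * (g ^ n)⁻¹ = g ^ (2 r n)`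
    obtain ⟨n, hn⟩ := Subgroup.mem_zpowers_iff.mp (hg t)
    refine ⟨g ^ (r * n), ?_⟩
    rw [← hn, map_zpow, ← hk, ← zpow_mul, ← zpow_neg, ← zpow_add, ← zpow_add, hr]
    congr 1
    ring

namespace ThetaSetting.EtaleThetaData.DoubleUnderline

variable {p : ℕ} [Fact p.Prime] {D : ThetaSetting p} {E : D.EtaleThetaData} {l : ℕ}
  (C : E.DoubleUnderline l) {Es : Set ℕ+} (τ : D.CyclotomeTower l Es)

/-! ## §1 Generic: the discrepancy of an admissible `γ` keeping `b̂` geometric is a square -/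

/-- An element of `Π^tp_X̲̲` whose square lies in `Π^tp_Ÿ̲̲` has degree `0` (lies in `Π^tp_Y = Ker(Π^tp_X ↠ Z)`): `Z ≅ ℤ` is
torsion-free. [cite: MochizukiEtTh2009, §1 p.12] -/
theorem mem_GtpY_of_sq_mem_PiYdd (hC : D.Compat) (hS : D.Sec2Hyps) (x : C.Huu)
    (hx : x ^ 2 ∈ (C.thetaEnvTower τ hC hS).PiYdd) : (x : D.PiTemp) ∈ D.GtpY := by
  have h2 : ((x ^ 2 : C.Huu) : D.PiTemp) ∈ D.GtpY := by
    have h := (Subgroup.mem_subgroupOf.mp hx)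
    rw [D.GtpYdd_eq_GtpYN_two hS] at h
    exact D.GtpYN_le 2 h
  rw [ThetaSetting.GtpY, MonoidHom.mem_ker] at h2 ⊢
  rw [Subgroup.coe_pow, map_pow] at h2
  have h3 : 2 • Multiplicative.toAdd (D.toZ (x : D.PiTemp)) = 0 := by
    rw [← toAdd_pow, h2, toAdd_one]
  have h4 : Multiplicative.toAdd (D.toZ (x : D.PiTemp)) = 0 := by
    rcases (smul_eq_zero.mp h3) with h | h
    · exact absurd h two_ne_zero
    · exact h
  exact Multiplicative.toAdd.injective h4

/-- `γ⁻¹` also stabilises `Π^tp_Ÿ̲̲`: if `γ x ∈ Π^tp_Ÿ̲̲` then `x ∈ Π^tp_Ÿ̲̲`. [cite: MochizukiEtTh2009, Cor 2.19 (iii) p.64] -/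
theorem mem_PiYdd_of_apply_mem (hC : D.Compat) (hS : D.Sec2Hyps)
    (γ : (C.thetaEnvTower τ hC hS).PiX ≃ₜ* (C.thetaEnvTower τ hC hS).PiX)
    (hγ : (C.thetaEnvTower τ hC hS).PiYdd.map γ.toMulEquiv.toMonoidHom = (C.thetaEnvTower τ hC hS).PiYdd)
    {x : C.Huu} (hx : γ x ∈ (C.thetaEnvTower τ hC hS).PiYdd) : x ∈ (C.thetaEnvTower τ hC hS).PiYdd := by
  rw [← hγ] at hx
  obtain ⟨y, hy, hyx⟩ := hx
  have : y = x := γ.injective hyx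
  exact this ▸ hy

/-- **`w := γ b̂ · b̂⁻¹ ∈ Π^tp_Ÿ̲̲`.**  For `b̂ ∈ Π^tp_X̲̲` with `b̂² ∈ Π^tp_Ÿ̲̲` and `γ` stabilising `Π^tp_Ÿ̲̲`: `γ b̂` and `b̂` both have
degree `0`, and both or neither lie in `Π^tp_Ÿ̲̲`, which has index `2` in `Π^tp_Y` ("`Π^tp_X/Π^tp_Ÿ ≅ Z × μ₂`", p. 41;
`relIndex_GtpYdd_GtpY`). [cite: MochizukiEtTh2009, Def 2.7 p.41] -/
theorem apply_mul_inv_mem_PiYdd (hC : D.Compat) (hS : D.Sec2Hyps)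
    (γ : (C.thetaEnvTower τ hC hS).PiX ≃ₜ* (C.thetaEnvTower τ hC hS).PiX)
    (hγ : (C.thetaEnvTower τ hC hS).PiYdd.map γ.toMulEquiv.toMonoidHom = (C.thetaEnvTower τ hC hS).PiYdd)
    (bh : C.Huu) (hb2 : bh ^ 2 ∈ (C.thetaEnvTower τ hC hS).PiYdd) :
    γ bh * bh⁻¹ ∈ (C.thetaEnvTower τ hC hS).PiYdd := by
  -- degrees
  have hbY : (bh : D.PiTemp) ∈ D.GtpY := C.mem_GtpY_of_sq_mem_PiYdd τ hC hS bh hb2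
  have hγb2 : (γ bh) ^ 2 ∈ (C.thetaEnvTower τ hC hS).PiYdd := by
    rw [← map_pow]; exact C.apply_mem_PiYdd τ hC hS γ hγ ⟨bh ^ 2, hb2⟩
  have hβY : ((γ bh : C.Huu) : D.PiTemp) ∈ D.GtpY := C.mem_GtpY_of_sq_mem_PiYdd τ hC hS (γ bh) hγb2
  -- index two inside `Π^tp_Y`
  have hidx : (D.GtpYdd.subgroupOf D.GtpY).index = 2 := D.relIndex_GtpYdd_GtpY hS
  have key := Subgroup.mul_mem_iff_of_index_two hidx
    (a := (⟨((γ bh : C.Huu) : D.PiTemp), hβY⟩ : D.GtpY)) (b := (⟨(bh : D.PiTemp), hbY⟩ : D.GtpY)⁻¹)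
  have hiff : ((⟨((γ bh : C.Huu) : D.PiTemp), hβY⟩ : D.GtpY) ∈ D.GtpYdd.subgroupOf D.GtpY ↔
      (⟨(bh : D.PiTemp), hbY⟩ : D.GtpY)⁻¹ ∈ D.GtpYdd.subgroupOf D.GtpY) := by
    rw [inv_mem_iff, Subgroup.mem_subgroupOf, Subgroup.mem_subgroupOf]
    change γ bh ∈ (C.thetaEnvTower τ hC hS).PiYdd ↔ bh ∈ (C.thetaEnvTower τ hC hS).PiYdd
    exact ⟨fun h => C.mem_PiYdd_of_apply_mem τ hC hS γ hγ h, fun h => C.apply_mem_PiYdd τ hC hS γ hγ ⟨bh, h⟩⟩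
  have hmem := key.mpr hiff
  rw [Subgroup.mem_subgroupOf] at hmem
  exact hmem

/-- **A root cocycle FACTORS THROUGH `θ` on geometric elements**: for geometric `k₁, k₂ ∈ Π^tp_Ÿ̲̲` with `θ k₁ = θ k₂`,
`f k₁ = f k₂` (`f` is multiplicative on geometric elements and `f = θ` on `θ⁻¹(Δ_Θ)`, [EtTh] Prop. 1.5 (iii) via
`rootCocycle_apply`). [cite: MochizukiEtTh2009, Prop 1.5 (iii) p.23] -/
theorem rootCocycle_apply_eq_of_toTheta_eq (hC : D.Compat) (h15 : Prop15iii E hC)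
    {f : contCocycles D.toTheta D.DeltaTheta C.GtpYdduu} (hf : f ∈ C.rootCocycles hC) (k₁ k₂ : C.GtpYdduu)
    (hk₁ : D.aug.toMonoidHom (k₁ : D.PiTemp) = 1) (hk₂ : D.aug.toMonoidHom (k₂ : D.PiTemp) = 1)
    (hθ : D.toTheta (k₁ : D.PiTemp) = D.toTheta (k₂ : D.PiTemp)) : f.1 k₁ = f.1 k₂ := by
  have hq : D.aug.toMonoidHom ((k₁ * k₂⁻¹ : C.GtpYdduu) : D.PiTemp) = 1 := by
    rw [Subgroup.coe_mul, Subgroup.coe_inv, map_mul, map_inv, hk₁, hk₂, inv_one, mul_one]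
  have hθq : D.toTheta ((k₁ * k₂⁻¹ : C.GtpYdduu) : D.PiTemp) = 1 := by
    rw [Subgroup.coe_mul, Subgroup.coe_inv, map_mul, map_inv, hθ, mul_inv_cancel]
  have h1 : f.1 (k₁ * k₂⁻¹) = 1 := by
    apply Subtype.ext
    rw [C.rootCocycle_apply hC h15 hf _ (by rw [hθq]; exact one_mem _), hθq, OneMemClass.coe_one]
  have h2 : f.1 k₁ = f.1 (k₁ * k₂⁻¹) * f.1 k₂ := by
    rw [← C.apply_mul_of_aug_eq_one f _ _ hq, inv_mul_cancel_right]
  rw [h2, h1, one_mul]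


/-- **`C.toLDelta` is onto `l·Δ_Θ`** (inside `Π^tp_X̲̲` the theta quotient meets `Δ_Θ` in exactly `l·Δ_Θ`, `map_toTheta_Huu`).
[cite: MochizukiEtTh2009, Prop 2.12 (i) p.45] -/
theorem exists_toLDelta_eq (x : D.lDeltaTheta l) :
    ∃ g : (D.lDeltaTheta l).comap (D.toTheta.comp C.Huu.subtype), C.toLDelta g = x := by
  have hx : (x : D.GtpTheta) ∈ C.Huu.map D.toTheta ⊓ D.DeltaTheta := by
    rw [C.map_toTheta_Huu]; exact x.2
  obtain ⟨⟨h, hh, hhx⟩, -⟩ := hx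
  refine ⟨⟨⟨h, hh⟩, ?_⟩, ?_⟩
  · rw [Subgroup.mem_comap, MonoidHom.coe_comp, Function.comp_apply, Subgroup.coe_subtype, hhx]
    exact x.2
  · apply Subtype.ext
    rw [coe_toLDelta]
    exact hhx

/-- **`red_M ∘ γ̃ = γ̄_M ∘ red_M` on `l·Δ_Θ`**: the level-`M` coefficient automorphism `γ̄_M` admitted for `γ` IS the reduction
of `γ̃` (compatibility binder of `Cor219_iii` + `hγΛ` + `toLDelta` onto). [cite: MochizukiEtTh2009, Cor 2.19 (iii) p.64] -/
theorem red_lDeltaAut_eq (hC : D.Compat) (hS : D.Sec2Hyps)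
    (γ : (C.thetaEnvTower τ hC hS).PiX ≃ₜ* (C.thetaEnvTower τ hC hS).PiX)
    (hL : (C.thetaEnvTower τ hC hS).lDeltaTheta.map γ.toMulEquiv.toMonoidHom = (C.thetaEnvTower τ hC hS).lDeltaTheta)
    (γΛ : D.lDeltaTheta l ≃* D.lDeltaTheta l)
    (hγΛ : ∀ (g : (C.thetaEnvTower τ hC hS).lDeltaTheta) (hg : γ g ∈ (C.thetaEnvTower τ hC hS).lDeltaTheta),
      C.toLDelta ⟨γ g, hg⟩ = γΛ (C.toLDelta g))
    (M : Es) (γμ : (C.thetaEnvTower τ hC hS).mu M ≃* (C.thetaEnvTower τ hC hS).mu M)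
    (hγμ : ∀ (g : (C.thetaEnvTower τ hC hS).lDeltaTheta) (hg : γ g ∈ (C.thetaEnvTower τ hC hS).lDeltaTheta),
      (C.thetaEnvTower τ hC hS).thetaMod M ⟨γ g, hg⟩ = γμ ((C.thetaEnvTower τ hC hS).thetaMod M g))
    (x : D.lDeltaTheta l) : (τ.mod M).red (γΛ x) = γμ ((τ.mod M).red x) := by
  obtain ⟨g, hg⟩ := C.exists_toLDelta_eq x
  have hγg : γ g ∈ (C.thetaEnvTower τ hC hS).lDeltaTheta := by
    have : γ g ∈ (C.thetaEnvTower τ hC hS).lDeltaTheta.map γ.toMulEquiv.toMonoidHom := ⟨g, g.2, rfl⟩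
    rwa [hL] at this
  have h := hγμ g hγg
  change (τ.mod M).red (C.toLDelta ⟨γ g, hγg⟩) = γμ ((τ.mod M).red (C.toLDelta g)) at h
  rwa [hγΛ g hγg, hg] at h

/-- `red_M ∘ γ̃⁻¹ = γ̄_M⁻¹ ∘ red_M`, the inverse form of `red_lDeltaAut_eq`. [cite: MochizukiEtTh2009, Cor 2.19 (iii) p.64] -/
theorem red_lDeltaAut_symm_eq (hC : D.Compat) (hS : D.Sec2Hyps)
    (γ : (C.thetaEnvTower τ hC hS).PiX ≃ₜ* (C.thetaEnvTower τ hC hS).PiX)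
    (hL : (C.thetaEnvTower τ hC hS).lDeltaTheta.map γ.toMulEquiv.toMonoidHom = (C.thetaEnvTower τ hC hS).lDeltaTheta)
    (γΛ : D.lDeltaTheta l ≃* D.lDeltaTheta l)
    (hγΛ : ∀ (g : (C.thetaEnvTower τ hC hS).lDeltaTheta) (hg : γ g ∈ (C.thetaEnvTower τ hC hS).lDeltaTheta),
      C.toLDelta ⟨γ g, hg⟩ = γΛ (C.toLDelta g))
    (M : Es) (γμ : (C.thetaEnvTower τ hC hS).mu M ≃* (C.thetaEnvTower τ hC hS).mu M)
    (hγμ : ∀ (g : (C.thetaEnvTower τ hC hS).lDeltaTheta) (hg : γ g ∈ (C.thetaEnvTower τ hC hS).lDeltaTheta),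
      (C.thetaEnvTower τ hC hS).thetaMod M ⟨γ g, hg⟩ = γμ ((C.thetaEnvTower τ hC hS).thetaMod M g))
    (x : D.lDeltaTheta l) : (τ.mod M).red (γΛ.symm x) = γμ.symm ((τ.mod M).red x) := by
  apply γμ.injective
  rw [MulEquiv.apply_symm_apply, ← C.red_lDeltaAut_eq τ hC hS γ hL γΛ hγΛ M γμ hγμ, MulEquiv.apply_symm_apply]

/-- **(β) — the even-level discrepancy of a Δ-stable admissible automorphism is a SQUARE.**  Over ANY §1 setting at an origin
(`D.IsEtThOrigin`), any `E`, any `X̲̲`-choice `C`, any cyclotome tower `τ` and level `M`: let `γ` be a bi-continuous automorphism of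
`Π^tp_X̲̲` stabilising `Π^tp_Ÿ̲̲` (`hγ`) and `θ⁻¹(l·Δ_Θ)` (clause (5), `hL`), with induced `γ̃ = γΛ` (`hγΛ`) and admitted level-`M`
coefficient automorphism `γ̄_M = γμ` (`hγμ`) — the binder shape of abc-iut-C-hgal-2's `cor219_iii_of_hearts`; let `f` be a root
cocycle and `F = Φ_γ f` its transport (clause (a) `hF`); let `b = b̂²` with `b̂ ∈ Π^tp_X̲̲` geometric and `b ∈ Π^tp_Ÿ̲̲`.  IF `γ b̂` is
geometric, THEN `red_M(F b) · red_M(f b)⁻¹` is a square in `μ_M`.  Proof: `w := γ b̂ · b̂⁻¹ ∈ Π^tp_Ÿ̲̲` is geometric,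
`γ b = w · (b̂ w b̂⁻¹) · b`, `f` is multiplicative and `θ`-determined on geometric elements (Prop. 1.5 (iii)), `θ(b̂ w b̂⁻¹) = θ w`
(`(Δ^tp_Y)^Θ` abelian, p. 12), so `f(γ b) = f(w)² f(b)` and `u₀ = γ̄_M⁻¹(red_M f w)² · (γ̄_M⁻¹ t · t⁻¹)`, `t = red_M f b`, a square by
§0.  [cite: MochizukiEtTh2009, Cor 2.19 (iii) p.64] -/
theorem isSquare_transport_discrepancy_of_aug_apply_eq_one (hC : D.Compat) (hS : D.Sec2Hyps)
    (h15 : Prop15iii E hC) (hO : D.IsEtThOrigin)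
    (γ : (C.thetaEnvTower τ hC hS).PiX ≃ₜ* (C.thetaEnvTower τ hC hS).PiX)
    (hγ : (C.thetaEnvTower τ hC hS).PiYdd.map γ.toMulEquiv.toMonoidHom = (C.thetaEnvTower τ hC hS).PiYdd)
    (hL : (C.thetaEnvTower τ hC hS).lDeltaTheta.map γ.toMulEquiv.toMonoidHom = (C.thetaEnvTower τ hC hS).lDeltaTheta)
    (γΛ : D.lDeltaTheta l ≃* D.lDeltaTheta l)
    (hγΛ : ∀ (g : (C.thetaEnvTower τ hC hS).lDeltaTheta) (hg : γ g ∈ (C.thetaEnvTower τ hC hS).lDeltaTheta),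
      C.toLDelta ⟨γ g, hg⟩ = γΛ (C.toLDelta g))
    (M : Es) (γμ : (C.thetaEnvTower τ hC hS).mu M ≃* (C.thetaEnvTower τ hC hS).mu M)
    (hγμ : ∀ (g : (C.thetaEnvTower τ hC hS).lDeltaTheta) (hg : γ g ∈ (C.thetaEnvTower τ hC hS).lDeltaTheta),
      (C.thetaEnvTower τ hC hS).thetaMod M ⟨γ g, hg⟩ = γμ ((C.thetaEnvTower τ hC hS).thetaMod M g))
    {f : contCocycles D.toTheta D.DeltaTheta C.GtpYdduu} (hf : f ∈ C.rootCocycles hC)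
    (F : C.GtpYdduu → D.lDeltaTheta l)
    (hF : ∀ g : (C.thetaEnvTower τ hC hS).PiYdd,
      F (C.inclYdduu g) = γΛ.symm ⟨(f.1 (C.inclYdduu ⟨γ g, C.apply_mem_PiYdd τ hC hS γ hγ g⟩) : D.GtpTheta), hf.1 _⟩)
    (bh : C.Huu) (hbh : D.aug.toMonoidHom (bh : D.PiTemp) = 1)
    (hb2 : bh ^ 2 ∈ (C.thetaEnvTower τ hC hS).PiYdd)
    (hγbh : D.aug.toMonoidHom ((γ bh : C.Huu) : D.PiTemp) = 1) :
    IsSquare ((τ.mod M).red (F (C.inclYdduu ⟨bh ^ 2, hb2⟩)) *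
      ((τ.mod M).red ⟨(f.1 (C.inclYdduu ⟨bh ^ 2, hb2⟩) : D.GtpTheta), hf.1 _⟩)⁻¹) := by
  -- the geometric element `w := γ b̂ · b̂⁻¹ ∈ Π^tp_Ÿ̲̲` and its `b̂`-conjugate
  have hw : γ bh * bh⁻¹ ∈ (C.thetaEnvTower τ hC hS).PiYdd := C.apply_mul_inv_mem_PiYdd τ hC hS γ hγ bh hb2
  have hwa : D.aug.toMonoidHom (((γ bh * bh⁻¹ : C.Huu)) : D.PiTemp) = 1 := by
    rw [Subgroup.coe_mul, Subgroup.coe_inv, map_mul, map_inv, hγbh, hbh, inv_one, mul_one]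
  have hc : bh * (γ bh * bh⁻¹) * bh⁻¹ ∈ (C.thetaEnvTower τ hC hS).PiYdd :=
    (C.thetaEnvTower τ hC hS).PiYdd_normal.conj_mem _ hw bh
  have hca : D.aug.toMonoidHom (((bh * (γ bh * bh⁻¹) * bh⁻¹ : C.Huu)) : D.PiTemp) = 1 := by
    rw [Subgroup.coe_mul, Subgroup.coe_mul, Subgroup.coe_inv, map_mul, map_mul, map_inv, hwa, hbh, mul_one, inv_one,
      mul_one]
  set kw : C.GtpYdduu := C.inclYdduu ⟨γ bh * bh⁻¹, hw⟩ with hkw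
  set kc : C.GtpYdduu := C.inclYdduu ⟨bh * (γ bh * bh⁻¹) * bh⁻¹, hc⟩ with hkc
  set kb : C.GtpYdduu := C.inclYdduu ⟨bh ^ 2, hb2⟩ with hkb
  have hkwa : D.aug.toMonoidHom (kw : D.PiTemp) = 1 := hwa
  have hkca : D.aug.toMonoidHom (kc : D.PiTemp) = 1 := hca
  -- `γ b = w · (b̂ w b̂⁻¹) · b`
  have hprod : C.inclYdduu ⟨γ (bh ^ 2), C.apply_mem_PiYdd τ hC hS γ hγ ⟨bh ^ 2, hb2⟩⟩ = kw * kc * kb := by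
    apply Subtype.ext
    change ((γ (bh ^ 2) : C.Huu) : D.PiTemp) =
      (((γ bh * bh⁻¹ : C.Huu)) : D.PiTemp) * (((bh * (γ bh * bh⁻¹) * bh⁻¹ : C.Huu)) : D.PiTemp) *
        (((bh ^ 2 : C.Huu)) : D.PiTemp)
    rw [map_pow]
    simp only [Subgroup.coe_mul, Subgroup.coe_inv, pow_two]
    group
  -- `θ(b̂ w b̂⁻¹) = θ(w)`: `(Δ^tp_Y)^Θ` is abelian
  have hbhY : (bh : D.PiTemp) ∈ D.GtpY := C.mem_GtpY_of_sq_mem_PiYdd τ hC hS bh hb2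
  have hbhD : D.toTheta (bh : D.PiTemp) ∈ D.DtpYTheta :=
    ⟨(bh : D.PiTemp), Subgroup.mem_inf.mpr ⟨hbhY, hbh⟩, rfl⟩
  have hwD : D.toTheta (((γ bh * bh⁻¹ : C.Huu)) : D.PiTemp) ∈ D.DtpYTheta :=
    ⟨(((γ bh * bh⁻¹ : C.Huu)) : D.PiTemp),
      Subgroup.mem_inf.mpr ⟨D.GtpYdd_le_GtpY (Subgroup.mem_subgroupOf.mp hw), hwa⟩, rfl⟩
  have hθc : D.toTheta (kc : D.PiTemp) = D.toTheta (kw : D.PiTemp) := by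
    change D.toTheta ((bh : D.PiTemp) * (((γ bh * bh⁻¹ : C.Huu)) : D.PiTemp) * (bh : D.PiTemp)⁻¹) =
      D.toTheta (((γ bh * bh⁻¹ : C.Huu)) : D.PiTemp)
    rw [map_mul, map_mul, map_inv, D.dtpYTheta_comm hO _ hbhD _ hwD, mul_inv_cancel_right]
  have hfc : f.1 kc = f.1 kw := C.rootCocycle_apply_eq_of_toTheta_eq hC h15 hf kc kw hkca hkwa hθc
  -- `f(γ b) = f(w)² · f(b)`
  have hkwca : D.aug.toMonoidHom ((kw * kc : C.GtpYdduu) : D.PiTemp) = 1 := by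
    rw [Subgroup.coe_mul, map_mul, hkwa, hkca, mul_one]
  have hfprod : f.1 (kw * kc * kb) = f.1 kw * f.1 kw * f.1 kb := by
    rw [C.apply_mul_of_aug_eq_one f (kw * kc) kb hkwca, C.apply_mul_of_aug_eq_one f kw kc hkwa, hfc]
  set xw : D.lDeltaTheta l := ⟨(f.1 kw : D.GtpTheta), hf.1 kw⟩ with hxw
  set xb : D.lDeltaTheta l := ⟨(f.1 kb : D.GtpTheta), hf.1 kb⟩ with hxb
  have hval : (⟨(f.1 (C.inclYdduu ⟨γ (bh ^ 2), C.apply_mem_PiYdd τ hC hS γ hγ ⟨bh ^ 2, hb2⟩⟩) : D.GtpTheta), hf.1 _⟩ :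
      D.lDeltaTheta l) = xw ^ 2 * xb := by
    apply Subtype.ext
    change ((f.1 (C.inclYdduu ⟨γ (bh ^ 2), C.apply_mem_PiYdd τ hC hS γ hγ ⟨bh ^ 2, hb2⟩⟩) : D.DeltaTheta) : D.GtpTheta) =
      ((f.1 kw : D.DeltaTheta) : D.GtpTheta) ^ 2 * ((f.1 kb : D.DeltaTheta) : D.GtpTheta)
    rw [hprod, hfprod, Subgroup.coe_mul, Subgroup.coe_mul, pow_two]
  have hFb : F kb = γΛ.symm (xw ^ 2 * xb) := by
    rw [hkb, hF ⟨bh ^ 2, hb2⟩, hval]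
  -- reduce modulo `M`: `red_M ∘ γ̃⁻¹ = γ̄_M⁻¹ ∘ red_M`
  have hred := C.red_lDeltaAut_symm_eq τ hC hS γ hL γΛ hγΛ M γμ hγμ
  rw [hFb, map_mul γΛ.symm, map_pow γΛ.symm, map_mul (τ.mod M).red, map_pow (τ.mod M).red, hred, hred, mul_assoc]
  exact (IsSquare.sq _).mul (isSquare_mulEquiv_apply_mul_inv γμ.symm _)

/-- **(β), SOCKET FORM for abc-iut-L1-t6's `heart_of_uniqueness_at'`**: if, in addition, every SQUARE of `μ_M` is a value
`red_M θ⁅(ã^m)⁻¹, b⁆` of the commutator character of a geometric `ã ∈ Π^tp_X̲̲` at `b = b̂²` (abc-iut-L1-t6, p487040: at the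
record pair the character is `m ↦ ζ^{-2m}` for a generator `ζ`), then the discrepancy IS such a value — the hypothesis `hred`
of the socket. [cite: MochizukiEtTh2009, Cor 2.19 (iii) p.64] -/
theorem exists_zpow_red_comm_eq_discrepancy_of_aug_apply_eq_one (hC : D.Compat) (hS : D.Sec2Hyps)
    (h15 : Prop15iii E hC) (hO : D.IsEtThOrigin)
    (γ : (C.thetaEnvTower τ hC hS).PiX ≃ₜ* (C.thetaEnvTower τ hC hS).PiX)
    (hγ : (C.thetaEnvTower τ hC hS).PiYdd.map γ.toMulEquiv.toMonoidHom = (C.thetaEnvTower τ hC hS).PiYdd)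
    (hL : (C.thetaEnvTower τ hC hS).lDeltaTheta.map γ.toMulEquiv.toMonoidHom = (C.thetaEnvTower τ hC hS).lDeltaTheta)
    (γΛ : D.lDeltaTheta l ≃* D.lDeltaTheta l)
    (hγΛ : ∀ (g : (C.thetaEnvTower τ hC hS).lDeltaTheta) (hg : γ g ∈ (C.thetaEnvTower τ hC hS).lDeltaTheta),
      C.toLDelta ⟨γ g, hg⟩ = γΛ (C.toLDelta g))
    (M : Es) (γμ : (C.thetaEnvTower τ hC hS).mu M ≃* (C.thetaEnvTower τ hC hS).mu M)
    (hγμ : ∀ (g : (C.thetaEnvTower τ hC hS).lDeltaTheta) (hg : γ g ∈ (C.thetaEnvTower τ hC hS).lDeltaTheta),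
      (C.thetaEnvTower τ hC hS).thetaMod M ⟨γ g, hg⟩ = γμ ((C.thetaEnvTower τ hC hS).thetaMod M g))
    {f : contCocycles D.toTheta D.DeltaTheta C.GtpYdduu} (hf : f ∈ C.rootCocycles hC)
    (F : C.GtpYdduu → D.lDeltaTheta l)
    (hF : ∀ g : (C.thetaEnvTower τ hC hS).PiYdd,
      F (C.inclYdduu g) = γΛ.symm ⟨(f.1 (C.inclYdduu ⟨γ g, C.apply_mem_PiYdd τ hC hS γ hγ g⟩) : D.GtpTheta), hf.1 _⟩)
    (bh : C.Huu) (hbh : D.aug.toMonoidHom (bh : D.PiTemp) = 1)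
    (hb2 : bh ^ 2 ∈ (C.thetaEnvTower τ hC hS).PiYdd)
    (hγbh : D.aug.toMonoidHom ((γ bh : C.Huu) : D.PiTemp) = 1)
    (a : C.Huu)
    (hsq : ∀ s : MuN p M, ∃ (m : ℤ) (hm : D.toTheta ((((a ^ m : C.Huu) : D.PiTemp))⁻¹ *
        (((⟨bh ^ 2, hb2⟩ : (C.thetaEnvTower τ hC hS).PiYdd) : C.Huu) : D.PiTemp) *
        ((a ^ m : C.Huu) : D.PiTemp) * ((((⟨bh ^ 2, hb2⟩ : (C.thetaEnvTower τ hC hS).PiYdd) : C.Huu) : D.PiTemp))⁻¹) ∈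
        D.lDeltaTheta l), (τ.mod M).red ⟨_, hm⟩ = s ^ 2) :
    ∃ (m : ℤ) (hm : D.toTheta ((((a ^ m : C.Huu) : D.PiTemp))⁻¹ *
        (((⟨bh ^ 2, hb2⟩ : (C.thetaEnvTower τ hC hS).PiYdd) : C.Huu) : D.PiTemp) *
        ((a ^ m : C.Huu) : D.PiTemp) * ((((⟨bh ^ 2, hb2⟩ : (C.thetaEnvTower τ hC hS).PiYdd) : C.Huu) : D.PiTemp))⁻¹) ∈
        D.lDeltaTheta l),
      (τ.mod M).red ⟨_, hm⟩ = (τ.mod M).red (F (C.inclYdduu ⟨bh ^ 2, hb2⟩)) *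
        ((τ.mod M).red ⟨(f.1 (C.inclYdduu ⟨bh ^ 2, hb2⟩) : D.GtpTheta), hf.1 _⟩)⁻¹ := by
  obtain ⟨s, hs⟩ := C.isSquare_transport_discrepancy_of_aug_apply_eq_one τ hC hS h15 hO γ hγ hL γΛ hγΛ M γμ hγμ hf F hF
    bh hbh hb2 hγbh
  obtain ⟨m, hm, hms⟩ := hsq s
  exact ⟨m, hm, by rw [hms, hs, pow_two]⟩

/-- **The socket hypothesis from ONE square root of the commutator value.**  If `⟨θ⁅ã⁻¹, b⁆⟩ = x₀^{-2}` in `l·Δ_Θ` and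
`red_M x₀` generates `μ_M` (every `u` is a power of it), then every SQUARE `s²` of `μ_M` is a commutator value
`red_M θ⁅(ã^m)⁻¹, b⁆` (`m := -n` for `s = (red_M x₀)^n`; bilinearity `θ⁅(ã^m)⁻¹, b⁆ = θ⁅ã⁻¹, b⁆^m` is abc-iut-f-142's
`toTheta_conj_zpow_comm`).  At the Tate model abc-iut-L1-t6 (p487040) supplies `x₀ = c^{ι(1)^l}` for a degree-`l` `ã` and `ŷ(b) = ι(1)²`.
[cite: MochizukiEtTh2009, Cor 2.19 (iii) p.64] -/
theorem forall_sq_eq_red_comm_of_eq_zpow_neg_two (hC : D.Compat) (hS : D.Sec2Hyps) (M : Es)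
    (a : C.Huu) (ha : D.aug.toMonoidHom (a : D.PiTemp) = 1)
    (b : (C.thetaEnvTower τ hC hS).PiYdd) (hb : D.aug.toMonoidHom ((b : C.Huu) : D.PiTemp) = 1)
    (h₁ : D.toTheta (((a : D.PiTemp))⁻¹ * ((b : C.Huu) : D.PiTemp) * (a : D.PiTemp) * (((b : C.Huu) : D.PiTemp))⁻¹) ∈
      D.lDeltaTheta l)
    (x₀ : D.lDeltaTheta l) (hx₀ : (⟨_, h₁⟩ : D.lDeltaTheta l) = x₀ ^ (-2 : ℤ))
    (hgen : ∀ u : MuN p M, ∃ n : ℤ, ((τ.mod M).red x₀) ^ n = u) :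
    ∀ s : MuN p M, ∃ (m : ℤ) (hm : D.toTheta ((((a ^ m : C.Huu) : D.PiTemp))⁻¹ * ((b : C.Huu) : D.PiTemp) *
        ((a ^ m : C.Huu) : D.PiTemp) * (((b : C.Huu) : D.PiTemp))⁻¹) ∈ D.lDeltaTheta l), (τ.mod M).red ⟨_, hm⟩ = s ^ 2 := by
  intro s
  obtain ⟨n, hn⟩ := hgen s
  have hpow : ∀ m : ℤ, D.toTheta ((((a ^ m : C.Huu) : D.PiTemp))⁻¹ * ((b : C.Huu) : D.PiTemp) *
      ((a ^ m : C.Huu) : D.PiTemp) * (((b : C.Huu) : D.PiTemp))⁻¹) =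
      D.toTheta (((a : D.PiTemp))⁻¹ * ((b : C.Huu) : D.PiTemp) * (a : D.PiTemp) * (((b : C.Huu) : D.PiTemp))⁻¹) ^ m := by
    intro m
    rw [Subgroup.coe_zpow]
    exact D.toTheta_conj_zpow_comm _ _ ha hb m
  have hm : D.toTheta ((((a ^ (-n) : C.Huu) : D.PiTemp))⁻¹ * ((b : C.Huu) : D.PiTemp) *
      ((a ^ (-n) : C.Huu) : D.PiTemp) * (((b : C.Huu) : D.PiTemp))⁻¹) ∈ D.lDeltaTheta l := by
    rw [hpow]; exact Subgroup.zpow_mem _ h₁ _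
  refine ⟨-n, hm, ?_⟩
  have hx₀' : D.toTheta (((a : D.PiTemp))⁻¹ * ((b : C.Huu) : D.PiTemp) * (a : D.PiTemp) * (((b : C.Huu) : D.PiTemp))⁻¹) =
      ((x₀ ^ (-2 : ℤ) : D.lDeltaTheta l) : D.GtpTheta) := congrArg Subtype.val hx₀
  have hval : D.toTheta ((((a ^ (-n) : C.Huu) : D.PiTemp))⁻¹ * ((b : C.Huu) : D.PiTemp) *
      ((a ^ (-n) : C.Huu) : D.PiTemp) * (((b : C.Huu) : D.PiTemp))⁻¹) = ((x₀ ^ (2 * n) : D.lDeltaTheta l) : D.GtpTheta) := by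
    rw [hpow (-n), hx₀', Subgroup.coe_zpow, Subgroup.coe_zpow, ← zpow_mul]
    congr 1
    ring
  have hel : (⟨_, hm⟩ : D.lDeltaTheta l) = x₀ ^ (2 * n) := Subtype.ext hval
  rw [hel, map_zpow, mul_comm, zpow_mul, hn, zpow_two, pow_two]

end ThetaSetting.EtaleThetaData.DoubleUnderline

end Literature.AnabelianGeometry.EtaleTheta

end
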